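import Summits.CriticalPhenomena.CardyFormulaZ2.Theorems.CardyUniqueLimitCardyRigidityFarFieldPathwise
import Summits.CriticalPhenomena.CardyFormulaZ2.Theorems.CardyUniqueLimitCardyRigidityFarFieldMeasurable
import Summits.CriticalPhenomena.CardyFormulaZ2.Theorems.CardyUniqueLimitCardyRigidityFarFieldMomentsCentered
import Summits.CriticalPhenomena.CardyFormulaZ2.Theorems.CardyUniqueLimitCardyRigidityFarFieldMomentsTwo

/-!
# The far-field moment engine of a regular driver (line `crossing-martingale`, crux `CardyRigidity`)

Instantiation of the abstract moment theorems (`…FarFieldMoments`, `…FarFieldMomentsCentered`,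
`…FarFieldMomentsTwo`) with the pathwise far-field lemmas (`…FarFieldPathwise`) for a REGULAR
driver `W` (`IsRegularDriver μ W 𝓕`: adapted, continuous paths from `0`, `sup_{u ≤ t} |W_u|`
dominated in `L³`), stub `stub_kernelAffineCardy` of crux `CardyRigidity`
(stmt-CriticalPhenomena-0746).

For a shape `0 < a < b < c`, a time `t > 0` and the scale `n`, let
`h n = η(X_{t ∧ ρₙ}) - η(a,b,c)` be the increment of the modulus of the three marks `n·(a,b,c)`
under the real Loewner flow driven by `W`, stopped at the tight level time `ρₙ`
(levels `na ∓ n^{3/4}`, gap level `n·min(b-a,c-b) - n^{3/4}`).  THEN (`moments`):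

* `h n` is measurable and `|h n| ≤ C n^{3/4}/n` surely, for large `n`;
* `n E[h n] → -S₁ E[W_t]`, `n² E[(h n)²] → S₁² E[W_t²]`;
* if `E[W_t] = 0`: `n² E[h n] → 2t S₂ - (S₁/b) E[W_t²]`,

with `S₁ = (b-a)(c-b)/(b²(c-a))` (translation coefficient of the modulus) and
`S₂ = S₁ (ab+bc+ca)/(abc)` (drift coefficient).  No property of any kernel `f` is involved.
-/

noncomputable section

open MeasureTheory Filter Set Topology
open scoped NNReal ENNReal
open Literature.Probability.RandomPlanarGeometry
open Literature.Probability.Process (exitTime untopA_coe)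

namespace Summit.CriticalPhenomena.CardyFormulaZ2.Cruxes.CardyRigidity.CrossingMartingale

namespace FarField

section Engine

variable {Ω : Type*} {mΩ : MeasurableSpace Ω} {μ : Measure Ω} [IsProbabilityMeasure μ]
  {W : Ω → ℝ≥0 → ℝ} {𝓕 : Filtration ℝ≥0 mΩ} {a b c : ℝ}

/-- `2t/n² → 0` along the naturals. [folklore] -/
theorem tendsto_driftScale (t : ℝ) : Tendsto (fun n : ℕ ↦ 2 * t / (n : ℝ) ^ 2) atTop (𝓝 0) :=
  tendsto_const_nhds.div_atTop ((tendsto_pow_atTop two_ne_zero).comp tendsto_natCast_atTop_atTop)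

/-- `2t/n² → 0` within `{0}ᶜ` along the naturals, for `t ≠ 0`. [folklore] -/
theorem tendsto_driftScale_nhdsWithin {t : ℝ} (ht : t ≠ 0) :
    Tendsto (fun n : ℕ ↦ 2 * t / (n : ℝ) ^ 2) atTop (𝓝[≠] 0) := by
  refine tendsto_nhdsWithin_iff.2 ⟨tendsto_driftScale t, ?_⟩
  filter_upwards [eventually_gt_atTop 0] with n hn
  have hnpos : (0 : ℝ) < n := by exact_mod_cast hn
  simp only [mem_compl_iff, mem_singleton_iff]
  exact div_ne_zero (mul_ne_zero two_ne_zero ht) (by positivity)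

/-- A convergent real sequence is eventually bounded by its limit plus one. [folklore] -/
theorem eventually_le_of_tendsto {u : ℕ → ℝ} {l : ℝ} (h : Tendsto u atTop (𝓝 l)) :
    ∀ᶠ n in atTop, u n ≤ l + 1 :=
  (h.eventually (Iic_mem_nhds (lt_add_one l))).mono fun _ hn ↦ hn

set_option maxHeartbeats 1600000 in
-- one long instantiation: five eventual hypotheses, three abstract moment theorems
/-- **The far-field moment engine.**  For a regular driver, a shape `0 < a < b < c` and a time
`t > 0`, the increments `h n` of the level-stopped modulus at scale `n` are eventually measurable,
surely `O(n^{-1/4})`, and have the moments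
`n E[h n] → -S₁ E[W_t]`, `n² E[(h n)²] → S₁² E[W_t²]`, and, if `E[W_t] = 0`,
`n² E[h n] → 2t S₂ - (S₁/b) E[W_t²]`. [cite: LawlerSchrammWerner2001, §3] -/
theorem moments (hreg : IsRegularDriver μ W 𝓕) (ha : 0 < a) (hab : a < b) (hbc : b < c)
    {t : ℝ≥0} (ht : 0 < t) {h : ℕ → Ω → ℝ}
    (hh : ∀ n ω, h n ω = etaProc W (fun i ↦ (n : ℝ) * ![a, b, c] i)
        (min (t : WithTop ℝ≥0) (levelTime W (fun i ↦ (n : ℝ) * ![a, b, c] i)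
          (n * a - (n : ℝ) ^ (3 / 4 : ℝ)) (n * a + (n : ℝ) ^ (3 / 4 : ℝ))
          (n * min (b - a) (c - b) - (n : ℝ) ^ (3 / 4 : ℝ)) ω)).untopA ω - cardyEta a b c) :
    (∀ᶠ n : ℕ in atTop, Measurable (h n)) ∧
    (∃ C : ℝ, ∀ᶠ n : ℕ in atTop, ∀ ω, |h n ω| ≤ C * ((n : ℝ)) ^ (3 / 4 : ℝ) / n) ∧
    Tendsto (fun n : ℕ ↦ (n : ℝ) * ∫ ω, h n ω ∂μ) atTop
      (𝓝 (-((b - a) * (c - b) / (b ^ 2 * (c - a)) * ∫ ω, W ω t ∂μ))) ∧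
    Tendsto (fun n : ℕ ↦ (n : ℝ) ^ 2 * ∫ ω, (h n ω) ^ 2 ∂μ) atTop
      (𝓝 (((b - a) * (c - b) / (b ^ 2 * (c - a))) ^ 2 * ∫ ω, (W ω t) ^ 2 ∂μ)) ∧
    (∫ ω, W ω t ∂μ = 0 →
      Tendsto (fun n : ℕ ↦ (n : ℝ) ^ 2 * ∫ ω, h n ω ∂μ) atTop
        (𝓝 (2 * t * ((b - a) * (c - b) / (b ^ 2 * (c - a)) * ((a * b + b * c + c * a) / (a * b * c)))
          - (b - a) * (c - b) / (b ^ 2 * (c - a)) / b * ∫ ω, (W ω t) ^ 2 ∂μ))) := by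
  -- the driver data
  have hWad : StronglyAdapted 𝓕 (fun t ω ↦ W ω t) := hreg.1
  have hWc : ∀ ω, Continuous (W ω) := hreg.2.1
  have hW0 : ∀ ω, W ω 0 = 0 := hreg.2.2.1
  obtain ⟨B, hBm, hB3, hB0, hsup⟩ := exists_stronglyMeasurable_dominator hreg t
  have hXm : Measurable fun ω ↦ W ω t := measurable_driver_at hreg t
  have hXB : ∀ᵐ ω ∂μ, |W ω t| ≤ B ω := hsup.mono fun ω hω ↦ hω t le_rfl
  have hb : 0 < b := ha.trans hab
  have hc : 0 < c := hb.trans hbc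
  have hca : 0 < c - a := by linarith
  have htR : (0 : ℝ) < t := by exact_mod_cast ht
  -- the shape constants
  set S₁ : ℝ := (b - a) * (c - b) / (b ^ 2 * (c - a)) with hS₁
  set L : ℝ := 10 * c * (c - b) / (b * (c - a) ^ 2) + 6 * a * c / (b ^ 2 * (c - a)) +
    10 * a * (b - a) / (b * (c - a) ^ 2) with hL
  have hLnn : 0 ≤ L := by
    have h1 : 0 ≤ c - b := by linarith
    have h2 : 0 ≤ b - a := by linarith
    rw [hL]; positivity
  -- the deterministic sequences
  set r : ℕ → ℝ := fun n ↦ 2 * (t : ℝ) / (n : ℝ) ^ 2 with hr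
  set S : ℕ → ℝ := fun n ↦ (b + r n / b - (a + r n / a)) * (c + r n / c - (b + r n / b)) /
    ((b + r n / b) ^ 2 * (c + r n / c - (a + r n / a))) with hS
  set P : ℕ → ℝ := fun n ↦ S n / (b + r n / b) with hP
  set D : ℕ → ℝ := fun n ↦ cardyEta (a + r n / a) (b + r n / b) (c + r n / c) - cardyEta a b c
    with hD
  have hrt : Tendsto r atTop (𝓝 0) := tendsto_driftScale _
  have hrt' : Tendsto r atTop (𝓝[≠] 0) := tendsto_driftScale_nhdsWithin htR.ne'
  have hSt : Tendsto S atTop (𝓝 S₁) := (tendsto_S₁_drift ha hab hbc).comp hrt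
  have hbt : Tendsto (fun n ↦ b + r n / b) atTop (𝓝 b) := (tendsto_mid_drift b).comp hrt
  have hPt : Tendsto P atTop (𝓝 (S₁ / b)) := hSt.div hbt hb.ne'
  have hDt : Tendsto (fun n : ℕ ↦ (n : ℝ) ^ 2 * D n) atTop
      (𝓝 (2 * t * (S₁ * ((a * b + b * c + c * a) / (a * b * c))))) := by
    have hsl := ((tendsto_cardyEta_drift_slope ha hab hbc).comp hrt').const_mul (2 * (t : ℝ))
    refine hsl.congr' ?_
    filter_upwards [eventually_gt_atTop 0] with n hn
    have hnpos : (0 : ℝ) < n := by exact_mod_cast hn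
    simp only [Function.comp, hD, hr]
    field_simp
  -- the scale conditions
  have hscale := eventually_scale ha hab hbc (t : ℝ) t.coe_nonneg
  have hq1 : ∀ᶠ n : ℕ in atTop, (1 : ℝ) ≤ ((n : ℝ)) ^ (3 / 4 : ℝ) := eventually_le_rpow 1
  -- (1) measurability
  have hhm : ∀ᶠ n : ℕ in atTop, Measurable (h n) := by
    filter_upwards [hscale] with n hn
    obtain ⟨hn0, hq, -, -, -, -⟩ := hn
    have hfun : h n = fun ω ↦ etaProc W (fun i ↦ (n : ℝ) * ![a, b, c] i)
        (min (t : WithTop ℝ≥0) (levelTime W (fun i ↦ (n : ℝ) * ![a, b, c] i)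
          (n * a - (n : ℝ) ^ (3 / 4 : ℝ)) (n * a + (n : ℝ) ^ (3 / 4 : ℝ))
          (n * min (b - a) (c - b) - (n : ℝ) ^ (3 / 4 : ℝ)) ω)).untopA ω - cardyEta a b c :=
      funext (hh n)
    rw [hfun]
    exact (measurable_etaProc_stopped hWad hWc hW0 (admissibleLevels_scale ha hab hbc hn0 hq)
      t).sub_const _
  -- (2) the sure bound, `C = 6 L`
  have hsure : ∀ᶠ n : ℕ in atTop, ∀ ω, |h n ω| ≤ 6 * L * ((n : ℝ)) ^ (3 / 4 : ℝ) / n := by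
    filter_upwards [hscale, hq1] with n hn hq1n ω
    obtain ⟨hn0, hq, hqa, h4t, hρ, -⟩ := hn
    have hnpos : (0 : ℝ) < n := by exact_mod_cast hn0
    rw [hh n ω]
    refine (abs_incr_le_sure ha hab hbc t hn0 hq hqa h4t hρ (hWc ω) (hW0 ω)).trans ?_
    rw [← hL]
    have : (((n : ℝ)) ^ (3 / 4 : ℝ) + 1) / n ≤ 2 * ((n : ℝ)) ^ (3 / 4 : ℝ) / n := by
      rw [div_le_div_iff_of_pos_right hnpos]; linarith
    calc L * (3 * ((((n : ℝ)) ^ (3 / 4 : ℝ) + 1) / n))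
        ≤ L * (3 * (2 * ((n : ℝ)) ^ (3 / 4 : ℝ) / n)) := by gcongr
      _ = 6 * L * ((n : ℝ)) ^ (3 / 4 : ℝ) / n := by ring
  -- (3) the good-event expansion, `C' = (2 S₁/b² + 1) + 12 L t/a²`
  set C₁ : ℝ := 2 * S₁ / b ^ 2 + 1 with hC₁
  set C' : ℝ := C₁ + 12 * L * t / a ^ 2 with hC'
  have hS₁pos : 0 < S₁ := by
    have h1 : 0 < c - b := by linarith
    have h2 : 0 < b - a := by linarith
    rw [hS₁]; positivity
  have hC₁pos : 0 < C₁ := by rw [hC₁]; positivity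
  have hC'C₁ : C₁ ≤ C' := by
    rw [hC']; linarith [show (0 : ℝ) ≤ 12 * L * t / a ^ 2 by positivity]
  have hC'L : 12 * L * t / a ^ 2 ≤ C' := by rw [hC']; linarith
  have hcoef : ∀ᶠ n : ℕ in atTop, 2 * S n / (b + r n / b) ^ 2 ≤ C₁ := by
    have ht2 : Tendsto (fun n ↦ 2 * S n / (b + r n / b) ^ 2) atTop (𝓝 (2 * S₁ / b ^ 2)) :=
      (hSt.const_mul 2).div (hbt.pow 2) (pow_ne_zero 2 hb.ne')
    exact eventually_le_of_tendsto ht2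
  have hgood : ∀ᶠ n : ℕ in atTop, ∀ᵐ ω ∂μ, B ω ≤ ((n : ℝ)) ^ (3 / 4 : ℝ) / 2 →
      |h n ω - D n + S n * (W ω t / n) + P n * (W ω t / n) ^ 2| ≤
        C' * (B ω ^ 3 + B ω + 1) / (n : ℝ) ^ 3 := by
    filter_upwards [hscale, hcoef] with n hn hcoefn
    obtain ⟨hn0, hq, hqa, h4t, -, hρ'⟩ := hn
    have hnpos : (0 : ℝ) < n := by exact_mod_cast hn0
    filter_upwards [hsup] with ω hω hBq
    obtain ⟨hlt, hbound⟩ := abs_incr_sub_main_le_of_good ha hab hbc t hn0 hq hqa h4t hρ' (hWc ω)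
      (hW0 ω) (hB0 ω) (fun s hs ↦ hω s hs) hBq (r := r n) (by simp [hr])
    -- on the good event the clock `t ∧ ρₙ` is `t`
    have hclock : (min (t : WithTop ℝ≥0) (levelTime W (fun i ↦ (n : ℝ) * ![a, b, c] i)
        (n * a - (n : ℝ) ^ (3 / 4 : ℝ)) (n * a + (n : ℝ) ^ (3 / 4 : ℝ))
        (n * min (b - a) (c - b) - (n : ℝ) ^ (3 / 4 : ℝ)) ω)).untopA = t := by
      rw [min_eq_left hlt.le]; exact untopA_coe t
    have hrew : h n ω - D n + S n * (W ω t / n) + P n * (W ω t / n) ^ 2 =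
        etaProc W (fun i ↦ (n : ℝ) * ![a, b, c] i) t ω
          - cardyEta (a + r n / a) (b + r n / b) (c + r n / c)
          + (b + r n / b - (a + r n / a)) * (c + r n / c - (b + r n / b)) /
              ((b + r n / b) ^ 2 * (c + r n / c - (a + r n / a))) * (W ω t / n)
          + (b + r n / b - (a + r n / a)) * (c + r n / c - (b + r n / b)) /
              ((b + r n / b) ^ 2 * (c + r n / c - (a + r n / a))) / (b + r n / b) *
              (W ω t / n) ^ 2 := by
      rw [hh n ω, hclock]; simp only [hD, hS, hP]; ring
    rw [hrew]
    refine hbound.trans ?_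
    have hB := hB0 ω
    have hK3 : 0 ≤ B ω ^ 3 := by positivity
    -- first term
    have h1 : 2 * ((b + r n / b - (a + r n / a)) * (c + r n / c - (b + r n / b)) /
        ((b + r n / b) ^ 2 * (c + r n / c - (a + r n / a)))) / (b + r n / b) ^ 2 * (B ω / n) ^ 3
        ≤ C' * B ω ^ 3 / (n : ℝ) ^ 3 := by
      have : 2 * ((b + r n / b - (a + r n / a)) * (c + r n / c - (b + r n / b)) /
          ((b + r n / b) ^ 2 * (c + r n / c - (a + r n / a)))) / (b + r n / b) ^ 2 =
          2 * S n / (b + r n / b) ^ 2 := by rw [hS]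
      rw [this, div_pow, ← mul_div_assoc]
      exact div_le_div_of_nonneg_right (mul_le_mul_of_nonneg_right (hcoefn.trans hC'C₁) hK3)
        (by positivity)
    -- second term
    have h2 : L * (3 * (4 * (t : ℝ) * (B ω + 1) / (a ^ 2 * (n : ℝ) ^ 3))) ≤
        C' * (B ω + 1) / (n : ℝ) ^ 3 := by
      have : L * (3 * (4 * (t : ℝ) * (B ω + 1) / (a ^ 2 * (n : ℝ) ^ 3))) =
          12 * L * t / a ^ 2 * (B ω + 1) / (n : ℝ) ^ 3 := by field_simp; ring
      rw [this]
      exact div_le_div_of_nonneg_right (mul_le_mul_of_nonneg_right hC'L (by positivity))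
        (by positivity)
    have hsum : C' * B ω ^ 3 / (n : ℝ) ^ 3 + C' * (B ω + 1) / (n : ℝ) ^ 3 =
        C' * (B ω ^ 3 + B ω + 1) / (n : ℝ) ^ 3 := by ring
    rw [← hL, ← hsum]
    exact add_le_add h1 h2
  -- (4) the abstract moment theorems
  refine ⟨hhm, ⟨6 * L, hsure⟩, ?_, ?_, ?_⟩
  · exact tendsto_first_moment hXm hBm hB3 hB0 hXB hhm hsure hgood hSt hPt hDt
  · exact tendsto_second_moment hXm hBm hB3 hB0 hXB hhm hsure hgood hSt hPt hDt
  · intro hX0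
    exact tendsto_first_moment_of_centered hXm hBm hB3 hB0 hXB hhm hsure hgood hSt hPt hDt hX0

end Engine

end FarField

/-- **Registered form** (glue sub-goal `farField_moments` of stmt-CriticalPhenomena-0746): the far-field
moment engine of a regular driver. [cite: LawlerSchrammWerner2001, §3] -/
theorem farField_moments : ∀ {Ω : Type*} {mΩ : MeasurableSpace Ω} {μ : MeasureTheory.Measure Ω} [MeasureTheory.IsProbabilityMeasure μ] {W : Ω → ℝ≥0 → ℝ} {𝓕 : MeasureTheory.Filtration ℝ≥0 mΩ} {a b c : ℝ}, IsRegularDriver μ W 𝓕 → 0 < a → a < b → b < c → ∀ {t : ℝ≥0}, 0 < t → ∀ {h : ℕ → Ω → ℝ}, (∀ n ω, h n ω = etaProc W (fun i ↦ (n : ℝ) * ![a, b, c] i) (min (t : WithTop ℝ≥0) (levelTime W (fun i ↦ (n : ℝ) * ![a, b, c] i) (n * a - (n : ℝ) ^ (3 / 4 : ℝ)) (n * a + (n : ℝ) ^ (3 / 4 : ℝ)) (n * min (b - a) (c - b) - (n : ℝ) ^ (3 / 4 : ℝ)) ω)).untopA ω - cardyEta a b c) → (∀ᶠ n : ℕ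 in Filter.atTop, Measurable (h n)) ∧ (∃ C : ℝ, ∀ᶠ n : ℕ in Filter.atTop, ∀ ω, |h n ω| ≤ C * ((n : ℝ)) ^ (3 / 4 : ℝ) / n) ∧ Filter.Tendsto (fun n : ℕ ↦ (n : ℝ) * ∫ ω, h n ω ∂μ) Filter.atTop (nhds (-((b - a) * (c - b) / (b ^ 2 * (c - a)) * ∫ ω, W ω t ∂μ))) ∧ Filter.Tendsto (fun n : ℕ ↦ (n : ℝ) ^ 2 * ∫ ω, (h n ω) ^ 2 ∂μ) Filter.atTop (nhds (((b - a) * (c - b) / (b ^ 2 * (c - a))) ^ 2 * ∫ ω, (W ω t) ^ 2 ∂μ)) ∧ (∫ ω, W ω t ∂μ = 0 → Filter.Tendsto (fun n : ℕ ↦ (n : ℝ) ^ 2 * ∫ ω, h n ω ∂μ) Filter.atTop (nhds (2 * t * ((b - a) * (c - b) / (b ^ 2 * (c - a)) * ((a * b + b * c + c * a) / (a * b * c))) - (b - a) * (c - b) / (b ^ 2 * (c - a)) / b * ∫ ω, (W ω t) ^ 2 ∂μ))) :=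
  fun hreg ha hab hbc _ ht _ hh ↦ FarField.moments hreg ha hab hbc ht hh

end Summit.CriticalPhenomena.CardyFormulaZ2.Cruxes.CardyRigidity.CrossingMartingale

end
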